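import Literature.MathematicalPhysics.QuantumFieldTheory.Balaban1983to89.T4TreeGaugeFixing
import Summits.QuantumFields.Balaban3D.Carriers.RadialForest

/-!
# Lane `pub-balaban3d` (Bałaban CMP 102, d = 3 UV stability AS PRINTED) — carrier layer p1, part 2 (`Carriers.Formula10`):
# the gauge-fixed form **(10)** p. 258 of the renormalization transformation, in the push-forward reading (design decision D-1b)

Source: T. Bałaban, *Ultraviolet stability of three-dimensional lattice pure gauge field theories*, Commun. Math. Phys. **102**
(1985) 255–275 [Balaban1985UV3] ([B10]), p. 258 = PDF 4, read on the render
`run/shared/lean/pub/pub-balaban/b2b-balaban-ref1/pages/1985-cmp102-uv-stability-3d/…-p004-x2.png`: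
«The underintegral expression in Tρ₀ is invariant with respect to gauge transformations u fixed to 1 at points of the new
lattice T^{(1)}, i.e. u(y) = 1 for y ∈ T^{(1)}. We remove this freedom in the domain Ω₁ by a simple Faddeev–Popov procedure,
using the identity  Π_{y∈Ω₁^{(1)}} ∫ Π_{x∈B(y),x≠y} du(x) δ_{Ax(y)}(U^u) = 1,  (9)  δ_{Ax(y)}(U) = Π_{x∈B(y),x≠y} δ(U(Γ_{y,x})).
We obtain the following equality  (Tρ₀)(V) = Σ_{Ω₁} ∫dU δ(ŪV^{−1}) δ_{Ax(Ω₁)}(U) ζ_{Ω₁ᶜ} χ_{Ω₁} exp[−(1/g₀²)A(U) − E],  (10)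
where δ_{Ax(Ω₁)}(U) = Π_{y∈Ω₁^{(1)}} δ_{Ax(y)}(U).»  The contours `Γ_{y,x}` are those of [2] = [Balaban1984PropagatorsI] (1.7)
p. 18: from `y` to `x ∈ B(y)` «first in the direction of» the LAST coordinate, then the preceding ones (render
`…/1984-cmp95-propagators-rt-I/…-p002-x2.png`); in the tree's CENTRED block convention (cell pub-balaban DIVERGENCE F3) `y` is
the block centre `Setup.emb y`.

WHAT IS PROVED (standard measure theory, [folklore]; nothing of CMP 102 is asserted).  In the tree's push-forward reading of
`T` (`Setup.IsRT`: «∫dV (Tρ)(V) f(V) = ∫dU ρ(U) f(Ū)» for bounded measurable `f`; DIVERGENCE F7) the δ-function `δ_{Ax}` of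
(10) becomes «set the bond variables on the axial tree to 1 inside the integrand» (`T4TreeGaugeFixing.fixTo T 1`), and (10) reads
  `∫dV (Tρ)(V) f(V) = ∫dU ρ(U[T := 1]) f(Ū(U[T := 1]))`  (equivalently, by `T4TreeGaugeFixing.integral_fixTo_eq_integral_glue`,
  an integral over the bond variables OFF the tree only — print's «∫dU δ_{Ax}(U) …»).
§1 proves this for ANY bond set `T` carrying a peeling certificate (`T4AxialGaugeFixing.TreeOrder`) whose fresh ends avoid the
centres `emb y` («u(y) = 1 for y ∈ T^{(1)}»), ANY covariant averaging (`Setup.Averaging`, axiom (11) of [Balaban1985Averaging],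
standing range) and ANY gauge-invariant measurable density — from the 4D cell's tree-gauge theorem
`T4TreeGaugeFixing.lintegral_eq_lintegral_fixTo_of_treeOrder` (invariance is needed at the fresh ends only; the Faddeev–Popov
determinant of a tree gauge is 1, which is why (9) integrates to 1).  §2 constructs print's forest: the radial (axial) trees
`δ_{Ax(y)}`, `y ∈ Ω`, of the blocks of any set `Ω` of coarse sites, with an explicit peeling certificate whose fresh ends are the
non-central block sites, and §3 assembles **(10)**: `formula10`.  The partition of unity `Σ_{Ω₁} ζ_{Ω₁ᶜ}χ_{Ω₁} = 1` of (8) (LQB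
`B10Decomposition7.resummation8`) multiplies the integrand and is not repeated here; print fixes the gauge only inside `Ω₁`, which
is the parameter `Ω` of §2–§3.
-/

open MeasureTheory Function Finset
open scoped ENNReal

namespace Summit.QuantumFields.Balaban3D.Carriers

open Literature.MathematicalPhysics.QuantumFieldTheory.Balaban1983to89
open Literature.MathematicalPhysics.QuantumFieldTheory.Balaban1983to89.GaugeField (gaugeAct GaugeInvariant)
open Literature.MathematicalPhysics.QuantumFieldTheory.Balaban1983to89.T4AxialGaugeFixing (siteTransf gaugeAct_siteTransf_apply
  TreeOrder gaugeAct_const_one)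
open Literature.MathematicalPhysics.QuantumFieldTheory.Balaban1983to89.T4TreeGaugeFixing (fixTo measurable_fixTo
  lintegral_eq_lintegral_fixTo_of_treeOrder)

/-! ## §1 The renormalization transform of a gauge-invariant density, tested after tree gauge fixing -/

section Core

variable {P : Params} {j : ℕ} {G : Type*} [GaugeGroup G] [MeasurableSpace G] [HaarData G] [MeasurableMul G]
variable [DecidableEq (PBond P j)]

/-- LAW FORM of the 4D cell's tree-gauge theorem with invariance AT THE FRESH ENDS ONLY (the cell states the law/Bochner forms for
fully gauge-invariant `F`; the `lintegral` form it proves already has the weaker hypothesis): `F` and `F ∘ (·)[T := U₀]` have the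
same law under `dU`. [folklore] -/
theorem map_eq_map_fixTo_of_treeOrder {T : Finset (PBond P j)} {v : PBond P j → Site P j} {r : Site P j → ℕ}
    (hT : TreeOrder T v r) {α : Type*} [MeasurableSpace α] {F : GaugeField P j G → α} (hF : Measurable F)
    (hinv : ∀ b ∈ T, ∀ (g : G) (U : GaugeField P j G), F (gaugeAct (siteTransf (v b) g) U) = F U)
    (U₀ : GaugeField P j G) :
    (fieldMeasure P j G).map F = (fieldMeasure P j G).map (fun U => F (fixTo T U₀ U)) := by
  have hF' : Measurable fun U => F (fixTo T U₀ U) := hF.comp (measurable_fixTo T U₀)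
  ext A hA
  rw [Measure.map_apply hF hA, Measure.map_apply hF' hA, ← lintegral_indicator_one (hF hA),
    ← lintegral_indicator_one (hF' hA)]
  have hind : Measurable fun U => (A.indicator (1 : α → ℝ≥0∞)) (F U) := (measurable_one.indicator hA).comp hF
  have key := lintegral_eq_lintegral_fixTo_of_treeOrder hT hind
    (fun b hb g U => by simp only [hinv b hb g U]) U₀
  have e1 : ∀ U, (F ⁻¹' A).indicator (1 : GaugeField P j G → ℝ≥0∞) U = A.indicator 1 (F U) := fun U => by
    simpa only [Pi.one_comp] using Set.indicator_comp_right F (s := A) (g := (1 : α → ℝ≥0∞)) (x := U)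
  have e2 : ∀ U, ((fun U => F (fixTo T U₀ U)) ⁻¹' A).indicator (1 : GaugeField P j G → ℝ≥0∞) U =
      A.indicator 1 (F (fixTo T U₀ U)) := fun U => by
    simpa only [Pi.one_comp] using
      Set.indicator_comp_right (fun U => F (fixTo T U₀ U)) (s := A) (g := (1 : α → ℝ≥0∞)) (x := U)
  calc ∫⁻ U, (F ⁻¹' A).indicator 1 U ∂fieldMeasure P j G
      = ∫⁻ U, A.indicator 1 (F U) ∂fieldMeasure P j G := lintegral_congr e1
    _ = ∫⁻ U, A.indicator 1 (F (fixTo T U₀ U)) ∂fieldMeasure P j G := key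
    _ = ∫⁻ U, ((fun U => F (fixTo T U₀ U)) ⁻¹' A).indicator 1 U ∂fieldMeasure P j G := (lintegral_congr e2).symm

/-- BOCHNER FORM with invariance at the fresh ends only: `∫ F dU = ∫ F(U[T := U₀]) dU`. [folklore] -/
theorem integral_eq_integral_fixTo_of_treeOrder {T : Finset (PBond P j)} {v : PBond P j → Site P j} {r : Site P j → ℕ}
    (hT : TreeOrder T v r) {F : GaugeField P j G → ℝ} (hF : Measurable F)
    (hinv : ∀ b ∈ T, ∀ (g : G) (U : GaugeField P j G), F (gaugeAct (siteTransf (v b) g) U) = F U)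
    (U₀ : GaugeField P j G) :
    ∫ U, F U ∂fieldMeasure P j G = ∫ U, F (fixTo T U₀ U) ∂fieldMeasure P j G := by
  have hF' : Measurable fun U => F (fixTo T U₀ U) := hF.comp (measurable_fixTo T U₀)
  have h1 : ∫ U, F U ∂fieldMeasure P j G = ∫ t, t ∂(fieldMeasure P j G).map F :=
    (integral_map hF.aemeasurable aestronglyMeasurable_id).symm
  have h2 : ∫ U, F (fixTo T U₀ U) ∂fieldMeasure P j G = ∫ t, t ∂(fieldMeasure P j G).map (fun U => F (fixTo T U₀ U)) :=
    (integral_map hF'.aemeasurable aestronglyMeasurable_id).symm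
  rw [h1, h2, map_eq_map_fixTo_of_treeOrder hT hF hinv U₀]

omit [MeasurableSpace G] [HaarData G] [MeasurableMul G] [DecidableEq (PBond P j)] in
/-- A covariant averaging ([Balaban1985Averaging] (11): `Ū(U^u) = (Ū)^{u∘emb}`) is INVARIANT under the one-site gauge
transformations at sites that are not block centres («u(y) = 1 for y ∈ T^{(1)}», [Balaban1985UV3] p. 258). Standing range. [folklore] -/
theorem avg_gaugeAct_siteTransf (av : Averaging P j G) (hj : j + 1 ≤ P.m + P.K) {x : Site P j}
    (hx : ∀ y : Site P (j+1), emb y ≠ x) (g : G) (U : GaugeField P j G) :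
    av.avg (gaugeAct (siteTransf x g) U) = av.avg U := by
  rw [av.covariant hj]
  have : (fun y : Site P (j+1) => siteTransf x g (emb y)) = fun _ => (1 : G) := by
    funext y
    exact T4AxialGaugeFixing.siteTransf_of_ne (hx y) g
  rw [this, gaugeAct_const_one]

/-- **D-1b, CORE FORM.**  Let `T` carry a peeling certificate whose fresh ends are not block centres, `Ū` a covariant averaging
(standing range), `ρ` a measurable gauge-invariant density and `ρ'` a renormalization transform of `ρ` in the push-forward
reading (`Setup.IsRT`).  Then for every bounded measurable `f`:
`∫dV ρ'(V) f(V) = ∫dU ρ(U[T := 1]) f(Ū(U[T := 1]))` — the bond variables on `T` may be set to `1` inside (10)'s integrand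
(«δ_{Ax}»; no Jacobian: the Faddeev–Popov factor (9) of a tree gauge is 1). [folklore] -/
theorem isRT_integral_eq_fixTo {T : Finset (PBond P j)} {v : PBond P j → Site P j} {r : Site P j → ℕ}
    (hT : TreeOrder T v r) (hv : ∀ b ∈ T, ∀ y : Site P (j+1), emb y ≠ v b)
    (av : Averaging P j G) (hj : j + 1 ≤ P.m + P.K) (havm : Measurable av.avg)
    {ρ : Density P j G} (hρm : Measurable ρ) (hρinv : GaugeInvariant ρ)
    {ρ' : Density P (j+1) G} (h : IsRT av.avg ρ ρ')
    (f : GaugeField P (j+1) G → ℝ) (hf : Measurable f) (hfC : ∃ C : ℝ, ∀ V, |f V| ≤ C) :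
    ∫ V, ρ' V * f V ∂fieldMeasure P (j+1) G
      = ∫ U, ρ (fixTo T 1 U) * f (av.avg (fixTo T 1 U)) ∂fieldMeasure P j G := by
  rw [h f hf hfC]
  exact integral_eq_integral_fixTo_of_treeOrder hT (hρm.mul (hf.comp havm))
    (fun b hb g U => by
      show ρ (gaugeAct (siteTransf (v b) g) U) * f (av.avg (gaugeAct (siteTransf (v b) g) U)) = ρ U * f (av.avg U)
      rw [hρinv, avg_gaugeAct_siteTransf av hj (hv b hb) g U]) 1

end Core

/-! ## §3 **(10)** assembled: the renormalization transform after axial gauge fixing in the blocks of `Ω` -/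

section Formula10

variable {P : Params} {j : ℕ} {G : Type*} [GaugeGroup G] [MeasurableSpace G] [HaarData G] [MeasurableMul G]
variable [DecidableEq (PBond P j)]

/-- **(10) p. 258 in the push-forward reading.**  For a covariant averaging `Ū` (standing range), a measurable gauge-invariant
density `ρ` (print: `ρ₀ ζ_{Ω₁ᶜ} χ_{Ω₁}`, a gauge-invariant function of the plaquette variables) and its renormalization transform
`ρ' = Tρ` (`Setup.IsRT`), and ANY set `Ω` of coarse sites (print: `Ω₁^{(1)}`): for every bounded measurable `f`,
`∫dV (Tρ)(V) f(V) = ∫dU ρ(U[Ax(Ω)]) f(Ū(U[Ax(Ω)]))`, where `U[Ax(Ω)] = U[radialBonds Ω := 1]` is `U` put in the axial gauge of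
the blocks over `Ω` — print's «(Tρ₀)(V) = ∫dU δ(ŪV^{−1}) δ_{Ax(Ω₁)}(U) … ρ₀(U)» with the δ-functions read as push-forward /
evaluation.  The further reduction to an integral over the bond variables OFF the forest only is
`T4TreeGaugeFixing.integral_fixTo_eq_integral_glue`. [cite: Balaban1985UV3, (10) p.258] -/
theorem formula10 (hj : j + 1 ≤ P.m + P.K) (Ω : Finset (Site P (j+1)))
    (av : Averaging P j G) (havm : Measurable av.avg)
    {ρ : Density P j G} (hρm : Measurable ρ) (hρinv : GaugeInvariant ρ)
    {ρ' : Density P (j+1) G} (h : IsRT av.avg ρ ρ')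
    (f : GaugeField P (j+1) G → ℝ) (hf : Measurable f) (hfC : ∃ C : ℝ, ∀ V, |f V| ≤ C) :
    ∫ V, ρ' V * f V ∂fieldMeasure P (j+1) G
      = ∫ U, ρ (fixTo (radialBonds Ω) 1 U) * f (av.avg (fixTo (radialBonds Ω) 1 U)) ∂fieldMeasure P j G :=
  isRT_integral_eq_fixTo (treeOrder_radialBonds hj Ω) (fun _ hb y => emb_ne_radialFresh hj hb y) av hj havm hρm hρinv h
    f hf hfC

/-- **(10), reduced-integral form**: the right-hand side as an integral over the bond variables off the forest only (`glue` puts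
`1` on the forest), print's «∫dU δ_{Ax(Ω₁)}(U) …». [cite: Balaban1985UV3, (10) p.258] -/
theorem formula10_glue (hj : j + 1 ≤ P.m + P.K) (Ω : Finset (Site P (j+1)))
    (av : Averaging P j G) (havm : Measurable av.avg)
    {ρ : Density P j G} (hρm : Measurable ρ) (hρinv : GaugeInvariant ρ)
    {ρ' : Density P (j+1) G} (h : IsRT av.avg ρ ρ')
    (f : GaugeField P (j+1) G → ℝ) (hf : Measurable f) (hfC : ∃ C : ℝ, ∀ V, |f V| ≤ C) :
    ∫ V, ρ' V * f V ∂fieldMeasure P (j+1) G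
      = ∫ W, ρ (T4TreeGaugeFixing.glue (radialBonds Ω) 1 W) * f (av.avg (T4TreeGaugeFixing.glue (radialBonds Ω) 1 W))
          ∂T4TreeGaugeFixing.freeMeasure (radialBonds Ω) := by
  rw [formula10 hj Ω av havm hρm hρinv h f hf hfC]
  exact T4TreeGaugeFixing.integral_fixTo_eq_integral_glue (radialBonds Ω) 1 (F := fun U => ρ U * f (av.avg U))
    (hρm.mul (hf.comp havm))

/-- **(10) with the partition of unity (8)** `1 = Σ_{Ω₁} ζ_{Ω₁ᶜ} χ_{Ω₁}` inserted, literally as printed: for weights `w i`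
(print: `ζ_{Ω₁ᶜ}χ_{Ω₁}`, gauge-invariant measurable functions of the plaquette variables with `Σ_i w i = 1` and `|w i| ≤ 1`), an
integrable measurable gauge-invariant `ρ` (print: `ρ₀ = exp[−(1/g₀²)A(U) − E]`), its renormalization transform `ρ' = Tρ` and the
gauge fixed in the blocks over `Ω i` in the `i`-th term (print: `δ_{Ax(Ω₁)}`):
`∫dV (Tρ)(V) f(V) = Σ_i ∫dU (w i · ρ)(U[Ax(Ω i)]) f(Ū(U[Ax(Ω i)]))` for every bounded measurable `f` — [Balaban1985UV3] (10)
p. 258 «(Tρ₀)(V) = Σ_{Ω₁} ∫dU δ(ŪV^{−1}) δ_{Ax(Ω₁)}(U) ζ_{Ω₁ᶜ} χ_{Ω₁} exp[−(1/g₀²)A(U) − E]» in the push-forward reading.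
[cite: Balaban1985UV3, (10) p.258] -/
theorem formula10_sum (hj : j + 1 ≤ P.m + P.K) {ι : Type*} (s : Finset ι) (Ω : ι → Finset (Site P (j+1)))
    (w : ι → Density P j G) (hwm : ∀ i ∈ s, Measurable (w i)) (hwinv : ∀ i ∈ s, GaugeInvariant (w i))
    (hwb : ∀ i ∈ s, ∀ U, |w i U| ≤ 1) (hws : ∀ U, ∑ i ∈ s, w i U = 1)
    (av : Averaging P j G) (havm : Measurable av.avg)
    {ρ : Density P j G} (hρm : Measurable ρ) (hρinv : GaugeInvariant ρ) (hρi : Integrable ρ (fieldMeasure P j G))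
    {ρ' : Density P (j+1) G} (h : IsRT av.avg ρ ρ')
    (f : GaugeField P (j+1) G → ℝ) (hf : Measurable f) (hfC : ∃ C : ℝ, ∀ V, |f V| ≤ C) :
    ∫ V, ρ' V * f V ∂fieldMeasure P (j+1) G
      = ∑ i ∈ s, ∫ U, (w i (fixTo (radialBonds (Ω i)) 1 U) * ρ (fixTo (radialBonds (Ω i)) 1 U))
          * f (av.avg (fixTo (radialBonds (Ω i)) 1 U)) ∂fieldMeasure P j G := by
  obtain ⟨C, hC⟩ := hfC
  rw [h f hf ⟨C, hC⟩]
  -- insert the partition of unity and split the integral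
  have hfb : ∀ U, ‖f (av.avg U)‖ ≤ C := fun U => by simpa [Real.norm_eq_abs] using hC (av.avg U)
  have hI : Integrable (fun U => ρ U * f (av.avg U)) (fieldMeasure P j G) :=
    hρi.mul_bdd (hf.comp havm).aestronglyMeasurable (Filter.Eventually.of_forall hfb)
  have hIi : ∀ i ∈ s, Integrable (fun U => w i U * (ρ U * f (av.avg U))) (fieldMeasure P j G) := fun i hi =>
    hI.bdd_mul (hwm i hi).aestronglyMeasurable
      (Filter.Eventually.of_forall fun U => by simpa [Real.norm_eq_abs] using hwb i hi U)
  have hsplit : (fun U => ρ U * f (av.avg U)) = fun U => ∑ i ∈ s, w i U * (ρ U * f (av.avg U)) := by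
    funext U; rw [← Finset.sum_mul, hws U, one_mul]
  rw [hsplit, integral_finsetSum s hIi]
  refine Finset.sum_congr rfl fun i hi => ?_
  -- gauge-fix the `i`-th term in the blocks over `Ω i`
  have key := integral_eq_integral_fixTo_of_treeOrder (treeOrder_radialBonds hj (Ω i))
    (F := fun U => w i U * (ρ U * f (av.avg U))) ((hwm i hi).mul (hρm.mul (hf.comp havm)))
    (fun b hb g U => by
      show w i (gaugeAct (siteTransf (radialFresh b) g) U) * (ρ (gaugeAct (siteTransf (radialFresh b) g) U)
          * f (av.avg (gaugeAct (siteTransf (radialFresh b) g) U))) = w i U * (ρ U * f (av.avg U))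
      rw [hwinv i hi, hρinv, avg_gaugeAct_siteTransf av hj (fun y => emb_ne_radialFresh hj hb y) g U]) 1
  rw [key]
  refine integral_congr_ae (Filter.Eventually.of_forall fun U => ?_)
  simp only [mul_assoc]

end Formula10

end Summit.QuantumFields.Balaban3D.Carriers
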